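import Summits.Ventures.PercRepro.Night2T3LinesB
import Summits.Ventures.PercRepro.Night2TIdentity
import Summits.Ventures.PercRepro.PerFlatTransfer

/-!
# PercRepro — the type-`4` balance in the cyclic-rank profile, and the two CORE facts (night-2, gen 4)

The profile LP of `NIGHT-2-profile.md` §3b–§3e certifies the type-`3` layer corank by corank from the Lean facts
(P1)–(P3), (L1)–(L5′) and absorption.  The same facts with the TYPE-`4` objective (`Jq_four_mul_succ_eq`) and two facts
of the core certify the type-`4` layer at `q = 5` at every corank `≤ 16` (mining/night-2/g4/): this file is the Lean
side of that LP.

* `Jq_four_mul_succ_eq_profile`: `(q+1)·J_4 = (q+2)·DF_4 + Σ_k Σ_m #Pc k m · ((q+1)(q−2)/(1+m) − (q+2))`;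
* `sum_card_Pc_le_DFq_four`: the levels `0 … 3` are demand-free at type `4` (a complement of `≤ 3` points has rank
  `≤ 3`);
* `Nl_eq_zero_of_lines_le_three`: when every line of `M` has `≤ 3` points there is no line with `≥ 4` points of `G`
  (`N_ℓ = 0` for `ℓ ≥ 4`; the core: `card_le_three_of_line_of_core`);
* `card_Pc_eq_zero_of_planes_le_six`: when every plane of `M` has `≤ 6` points, a plane-type set (`m(S) = q − 3`:
  cyclic part of rank `3`, inside the plane `cl(Z)`) has nullity `≤ 3` — `#Pc k (q−3) = 0` for `d − k ≥ 4`
  (the core: night-3's `card_le_six_of_core`);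
* `Jq_four_nonneg_of_card_le_add_three`: at corank `≤ 3` every set is demand-free at type `4`, so `0 ≤ J_4`.

Imports `Night2T3LinesB` (the profile and line facts), `Night2TIdentity` (the type-`4` identity) and `PerFlatTransfer`
(`flatsQ`).
-/
namespace PercRepro.Star

open Finset ThmH SixFour GenQ PerFlat

variable {α : Type*} [DecidableEq α] {M : Matroid α} [M.Finite]

/-! ## The type-`4` balance in the profile -/

/-- `(q+1)·J_4 = (q+2)·DF_4 + Σ_{k ≤ d} Σ_m #Pc k m · ((q+1)(q−2)/(1+m) − (q+2))`. -/
theorem Jq_four_mul_succ_eq_profile {G : Finset α} {q d : ℕ} (hG : G ⊆ gr M)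
    (hrG : M.eRk (G : Set α) = (q : ℕ∞)) (hcard : G.card = q + d) :
    ((q : ℚ) + 1) * Jq M G q 4 = ((q : ℚ) + 2) * (DFq M G q 4 : ℚ) +
      ∑ k ∈ Finset.range (d + 1), ∑ m ∈ Finset.Icc (mTr M G) q,
        ((Pc M G q k m).card : ℚ) * (((q : ℚ) + 1) * ((q : ℚ) - 2) / (1 + (m : ℚ)) - ((q : ℚ) + 2)) := by
  rw [Jq_four_mul_succ_eq]
  congr 1
  have h := sum_Rq_eq_sum_Pc hG hrG hcard
    (fun _ m => ((q : ℚ) + 1) * ((q : ℚ) - 2) / (1 + (m : ℚ)) - ((q : ℚ) + 2))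
  rw [← h]

/-- The sets whose complement has `≤ 3` points are demand-free at type `4`. -/
theorem card_filter_sdiff_le_three_le_DFq (G : Finset α) (q : ℕ) :
    ((Rq M G q).filter (fun S : Finset α => (G \ S).card ≤ 3)).card ≤ DFq M G q 4 := by
  unfold DFq
  apply Finset.card_le_card
  intro S hS
  rw [Finset.mem_filter] at hS ⊢
  refine ⟨hS.1, ?_⟩
  have h1 : M.eRk ((G \ S : Finset α) : Set α) ≤ ((G \ S).card : ℕ∞) := by
    have := M.eRk_le_encard ((G \ S : Finset α) : Set α)
    rwa [Set.encard_coe_eq_coe_finsetCard] at this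
  have h2 : ((G \ S).card : ℕ∞) ≤ (3 : ℕ∞) := by exact_mod_cast hS.2
  calc M.eRk ((G \ S : Finset α) : Set α) + 1 ≤ (3 : ℕ∞) + 1 := by gcongr; exact h1.trans h2
    _ = ((4 : ℕ) : ℕ∞) := by norm_num

/-- The levels `0`, `1`, `2`, `3` together are at most the sets with a complement of `≤ 3` points. -/
theorem card_four_le_card_filter_le_three (G : Finset α) (q : ℕ) :
    ((Rq M G q).filter (fun S : Finset α => (G \ S).card = 0)).card +
      ((Rq M G q).filter (fun S : Finset α => (G \ S).card = 1)).card +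
      ((Rq M G q).filter (fun S : Finset α => (G \ S).card = 2)).card +
      ((Rq M G q).filter (fun S : Finset α => (G \ S).card = 3)).card ≤
      ((Rq M G q).filter (fun S : Finset α => (G \ S).card ≤ 3)).card := by
  have h012 := card_three_le_card_filter_le_two (M := M) G q
  have hdisj : Disjoint ((Rq M G q).filter (fun S : Finset α => (G \ S).card ≤ 2))
      ((Rq M G q).filter (fun S : Finset α => (G \ S).card = 3)) := by
    rw [Finset.disjoint_filter]
    intro S _ h0 h1
    omega
  have hsub : (Rq M G q).filter (fun S : Finset α => (G \ S).card ≤ 2) ∪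
      (Rq M G q).filter (fun S : Finset α => (G \ S).card = 3) ⊆
      (Rq M G q).filter (fun S : Finset α => (G \ S).card ≤ 3) := by
    intro S hS
    simp only [Finset.mem_union, Finset.mem_filter] at hS ⊢
    rcases hS with ⟨h, h'⟩ | ⟨h, h'⟩ <;> exact ⟨h, by omega⟩
  have := Finset.card_le_card hsub
  rw [Finset.card_union_of_disjoint hdisj] at this
  omega

/-- **The levels `0 … 3` are demand-free at type `4`**: `Σ_{k ≤ 3} Σ_m #Pc k m ≤ DF_4`. -/
theorem sum_card_Pc_le_DFq_four {G : Finset α} {q : ℕ} (hG : G ⊆ gr M) (hrG : M.eRk (G : Set α) = (q : ℕ∞)) :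
    (∑ m ∈ Finset.Icc (mTr M G) q, (Pc M G q 0 m).card) + (∑ m ∈ Finset.Icc (mTr M G) q, (Pc M G q 1 m).card) +
      (∑ m ∈ Finset.Icc (mTr M G) q, (Pc M G q 2 m).card) +
      (∑ m ∈ Finset.Icc (mTr M G) q, (Pc M G q 3 m).card) ≤ DFq M G q 4 := by
  rw [← card_level_eq_sum_card_Pc hG hrG 0, ← card_level_eq_sum_card_Pc hG hrG 1,
    ← card_level_eq_sum_card_Pc hG hrG 2, ← card_level_eq_sum_card_Pc hG hrG 3]
  exact (card_four_le_card_filter_le_three (M := M) G q).trans (card_filter_sdiff_le_three_le_DFq (M := M) G q)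

/-! ## The two facts of the core -/

/-- When every line of `M` has `≤ 3` points, no line carries `≥ 4` points of `G`: `N_ℓ = 0` for `ℓ ≥ 4`. -/
theorem Nl_eq_zero_of_lines_le_three (hline : ∀ L ∈ flatsQ M 2, L.card ≤ 3) (G : Finset α) {l : ℕ}
    (hl : 4 ≤ l) : Nl M G l = 0 := by
  unfold Nl
  rw [Finset.card_eq_zero, Finset.filter_eq_empty_iff]
  intro L hL hLG
  have hL' := mem_lines.1 hL
  have h1 : L ∈ flatsQ M 2 := by
    rw [mem_flatsQ]
    exact ⟨hL'.1, hL'.2.1, by rw [hL'.2.2]; rfl⟩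
  have h2 := hline L h1
  have h3 : (L ∩ G).card ≤ L.card := Finset.card_le_card Finset.inter_subset_left
  omega

/-- When every plane of `M` has `≤ 6` points, a plane-type set of `G` (`m(S) = q − 3`) has nullity `≤ 3`:
`#Pc k (q−3) = 0` whenever `d − k ≥ 4`. -/
theorem card_Pc_eq_zero_of_planes_le_six (hplane : ∀ P ∈ flatsQ M 3, P.card ≤ 6) {G : Finset α} {q d : ℕ}
    (hG : G ⊆ gr M) (hq : 3 ≤ q) (hcard : G.card = q + d) {k : ℕ} (hk : k + 4 ≤ d) :
    (Pc M G q k (q - 3)).card = 0 := by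
  rw [Finset.card_eq_zero, Finset.eq_empty_iff_forall_notMem]
  intro S hS
  have hS' := mem_Pc.1 hS
  have hSG : S ⊆ G := (mem_Rq.1 hS'.1).1
  have hSg : S ⊆ gr M := hSG.trans hG
  -- the cyclic part `Z`
  have hZcard : (S \ coloopsOf M S).card = d - k + 3 := by
    rw [card_sdiff_coloopsOf, hS'.2.2]
    have h1 : (G \ S).card + S.card = G.card := by
      rw [Finset.card_sdiff_of_subset hSG]
      exact Nat.sub_add_cancel (Finset.card_le_card hSG)
    rw [hS'.2.1, hcard] at h1
    omega
  have hZr : M.eRk ((S \ coloopsOf M S : Finset α) : Set α) = 3 := by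
    have h := eRk_sdiff_coloopsOf_add_mTr hG hS'.1
    rw [hS'.2.2] at h
    obtain ⟨r, hr⟩ := exists_eRk_eq_nat (M := M) (S \ coloopsOf M S)
    rw [hr] at h ⊢
    have h' : r + (q - 3) = q := by exact_mod_cast h
    have : r = 3 := by omega
    rw [this]
    rfl
  have hZE : ((S \ coloopsOf M S : Finset α) : Set α) ⊆ M.E := by
    rw [← coe_gr M]
    exact Finset.coe_subset.2 (Finset.sdiff_subset.trans hSg)
  -- the plane `cl(Z)`
  have hP : clF M (S \ coloopsOf M S) ∈ flatsQ M 3 := by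
    rw [mem_flatsQ]
    refine ⟨?_, ?_, ?_⟩
    · intro x hx
      have hx' : x ∈ M.closure ((S \ coloopsOf M S : Finset α) : Set α) := by
        rw [← coe_clF]
        exact Finset.mem_coe.2 hx
      have := M.closure_subset_ground _ hx'
      rw [← coe_gr M] at this
      exact Finset.mem_coe.1 this
    · rw [coe_clF]
      exact M.isFlat_closure _
    · rw [coe_clF, M.eRk_closure_eq, hZr]
      rfl
  have hsub : S \ coloopsOf M S ⊆ clF M (S \ coloopsOf M S) := by
    intro x hx
    rw [← Finset.mem_coe, coe_clF]
    exact M.subset_closure _ hZE (Finset.mem_coe.2 hx)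
  have h7 := Finset.card_le_card hsub
  have h6 := hplane _ hP
  omega

/-! ## Corank `≤ 3`: every set is demand-free at type `4` -/

/-- At corank `≤ 3` every rank-`q` subset of `G` is demand-free at type `4`: `DF_4 = N_q`. -/
theorem DFq_four_eq_Nq_of_card_le_add_three {G : Finset α} {q : ℕ} (hcard : G.card ≤ q + 3) :
    DFq M G q 4 = Nq M G q := by
  unfold DFq Nq
  rw [Finset.filter_true_of_mem]
  intro S hS
  have hS' := mem_Rq.1 hS
  have h1 : q ≤ S.card := le_card_of_eRk_eq hS'.2
  have h2 : (G \ S).card = G.card - S.card := Finset.card_sdiff_of_subset hS'.1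
  have h3 : (G \ S).card ≤ 3 := by omega
  have h4 : M.eRk ((G \ S : Finset α) : Set α) ≤ ((G \ S).card : ℕ∞) := by
    have := M.eRk_le_encard ((G \ S : Finset α) : Set α)
    rwa [Set.encard_coe_eq_coe_finsetCard] at this
  have h5 : ((G \ S).card : ℕ∞) ≤ (3 : ℕ∞) := by exact_mod_cast h3
  calc M.eRk ((G \ S : Finset α) : Set α) + 1 ≤ (3 : ℕ∞) + 1 := by gcongr; exact h4.trans h5
    _ = ((4 : ℕ) : ℕ∞) := by norm_num

/-- **The type-`4` balance at corank `≤ 3`** (`q ≥ 2`): `(q+1)·J_4 = Σ_S (q+1)(q−2)·w_∞(S) ≥ 0`. -/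
theorem Jq_four_nonneg_of_card_le_add_three {G : Finset α} {q : ℕ} (hq : 2 ≤ q) (hcard : G.card ≤ q + 3) :
    0 ≤ Jq M G q 4 := by
  have hpos : (0 : ℚ) < (q : ℚ) + 1 := by positivity
  suffices h : 0 ≤ ((q : ℚ) + 1) * Jq M G q 4 from le_of_mul_le_mul_left (by rw [mul_zero]; exact h) hpos
  rw [Jq_mul_succ_eq, DFq_four_eq_Nq_of_card_le_add_three hcard]
  unfold Nq
  rw [Finset.card_eq_sum_ones, Nat.cast_sum, Finset.mul_sum, ← Finset.sum_add_distrib]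
  apply Finset.sum_nonneg
  intro S _
  have hw := wInf_pos (M := M) S
  have hq' : (2 : ℚ) ≤ q := by exact_mod_cast hq
  have h1 : (0 : ℚ) ≤ (q : ℚ) + 1 := by linarith
  have h2 : (0 : ℚ) ≤ (q : ℚ) + 2 - 4 := by linarith
  have h3 := mul_nonneg (mul_nonneg h1 h2) hw.le
  push_cast
  linarith

end PercRepro.Star
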